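import Summits.QuantumFields.BalabanUV.Beta.EriceRemainderEnclosureHistoryAutonomyOrder

/-!
# EriceRemainderEnclosureHistoryAutonomyComparisonDualOrbit — (E132) **THE DUAL ORBIT GAUGE, FIRST BRICKS: comparison from the dual step quantities, and the
# dual window gap bounded by their sum — the two order lemmas of the lattice transcription of the continuum theorem (D‴) («every isotone excess of any size
# compares», `HOME/b2b-balaban-beta-d4-p2/g103/README.md` §2, §4 (3″)).**
The lattice comparison files (E118)–(E126) fix a BASE orbit `h = S y` and start a fresh PERTURBED orbit `S′(h_m)` at each of its pins; relating the perturbed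
configurations from two consecutive base pins costs the pin sensitivity of `B′ = B + E`, hence the excess MODULUS `ME` ((E118a) `pinSens_le`, `conf_incr_ge`) and,
for steep excesses, the relative-size tenth of (E121e)∕(E124)∕(E125).  The continuum proof of g103 has ONE perturbed curve and the excess enters only through the
monotonicity of the source along it.  THE DUAL BOOKKEEPING does the same on the lattice: fix ONE orbit `h′` of the perturbed functional `B′` (ANY functional — no
floor, modulus, monotonicity or sign of `B′ − B` is used in this file) from the pin `y`, and restart the BASE flow `B` (isotone, floor `b > 0`, modulus `M`, unique box
solutions `S p` from every pin — e.g. Bałaban's affine memory) at each of ITS points.  The DUAL STEP QUANTITY at depth `j` is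
    `X′_j := B′(h′_{j+1}, h′_{j+2}, …) − B((S h′_j)_1, (S h′_j)_2, …)`
(the perturbed orbit's effective β at its own pin `h′_j` minus the base's from the same pin).  §1 **`cmp_of_dual_steps_nonneg`**: if `X′_i ≥ 0` for `i < n` then
`h′_j ≤ (S y)_j` for `j ≤ n` — COMPARISON, by the one-step monotonicity of the base in its pin ((E48a) `le_of_pin_le`, `family_succ_eq`).  §2 the DUAL WINDOW GAP
`δ_k := 1∕h′_{j+k}² − 1∕(S h′_j)_k²` (perturbed level minus the level of the base RESTARTED at `h′_j`, `k` rows later): **`dual_gap_step`** `δ_{k+1} ≤ δ_k + X′_{j+k}`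
whenever `h′_{j+k} ≤ (S h′_j)_k` (base autonomy `family_tail_eq` + isotonicity of `B` + `le_of_pin_le`: the continuum's `D′ ≤ X`), and **`dual_gap_le_sum_steps`**
`0 ≤ δ_k ≤ Σ_{l<k} X′_{j+l}` under `X′ ≥ 0` below depth `j+k` — the (E63a)-type window bound with NO modulus of the excess anywhere.  What remains for the lattice
(D‴) (README §4 (3″) (c),(e)): the affine two-pin offset on the BASE side ((E118a) `pinSens_le` with `ME = 0`), the dual row inequality, and the gauge induction importing
(E131) `…ComparisonContinuumTimeBudget`.

Cell `pub-balaban`, β-function sub-cell, BINDER row D4 «RemainderConst leaves for Bałaban's split» (`HOME/BINDER-OWNERS.md`; owner lineage `b2b-balaban-beta-an4`;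
this file by co-owner #2 lineage `b2b-balaban-beta-d4-p2`, generation 103), β-FLOW TEAM duty (1), FREEZE (0) honoured (def-free; imports (E48a) `…AutonomyOrder`; uses
`family_zero` ∕ `family_mem` ∕ `family_tail_eq` ∕ `family_succ_eq` ∕ `le_of_pin_le` BY NAME; nothing restated).

HONEST FRAMING (page 1, verbatim and binding).  *"Discharging BetaPertH makes Bałaban's UV stability UNCONDITIONAL — a real constructive-QFT result; it is
NOT the continuum limit and NOT the Clay problem."*  THIS FILE DISCHARGES NOTHING OF THE KIND.  Elementary real analysis about ABSTRACT functionals on a box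
]0,γ]^ℕ — hypotheses of a census, not facts; the form, signs, ages and moments of Bałaban's (1.22) limit functional are NOT PRINTED ([I] p. 298; GAPS
G-t4-U2-1∕-2) and NOT asserted.  Row D4 class UNCHANGED (critical-path width 0; instance 0∕1; D4 DISCHARGE NO DATE).  NOT CLAIMED: the lattice comparison
theorem itself (the dual row inequality and the induction are NOT in this file); anything printed — NOT B12 Thm 2, NOT BetaPertH, NOT continuum, NOT Clay.

WHAT IS PROVED ([folklore]; 0 `def`, 0 sorry).  §1 **`cmp_of_dual_steps_nonneg`**.  §2 `dual_gap_zero`, **`dual_gap_step`**, **`dual_gap_le_sum_steps`**.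
v1.1 (same unit and generation) APPENDS §3 — three more bricks of the dual row inequality: **`dual_step_eq_drop`** (for the AFFINE base: `X′_j = E(tail_{j+1}h′) −
Σ_k L_k·((S h′_j)_{1+k} − h′_{j+1+k})`, the dual of (E118a) `step_eq_drop`), **`dual_source_antitone`** (the source read on the tails of ONE orbit only grows going
down: `(B′−B)(tail_{j+2}h′) ≤ (B′−B)(tail_{j+1}h′)` for an isotone excess — the lattice form of `ηe′ ≤ 0`, NO modulus), **`base_gap_damped`** ∕ **`dual_base_top_gap_le`**
(the two-pin offset on the BASE side: the base orbits from the consecutive perturbed pins `h′_{j+1}` (upper) and `h′_j` (lower) stay ordered, their level gap never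
exceeds the pin gap `1∕h′_{j+1}² − 1∕h′_j² = B′(tail_{j+1}h′)`, hence the age-`k` base tops differ in coupling by at most `cube∕2 ×` that — isotone `B` only) — and
modifies NO existing declaration.  v1.2 APPENDS §4 — «Φ₀√ℓ ISOTONE» ON THE LATTICE (the base speed at a higher top is not smaller than the level ratio allows —
the lower bound on the perturbed speed at its top used in the continuum deficit, g103 README §2 Step 1): **`one_step_ratio_le`** (the base one-step map `f : p ↦ (S p)_1`
has `f(p)∕p` antitone: `p′ ≤ p ⟹ f(p)·p′ ≤ f(p′)·p`, since `(p∕f(p))² = 1 + p²·B(tail S p)` grows with `p`), **`scale_ratio_le`** (iterating: `(S p)_k·p′ ≤ (S p′)_k·p` at every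
scale), **`affine_speed_ratio_le`** (for the affine base: `p′·B(tail_1 S p) ≤ p·B(tail_1 S p′)` — the effective β over the pin coupling is antitone in the pin).
-/

noncomputable section
open Finset Set

namespace Summit.QuantumFields.BalabanUV.Beta.EriceRemainderEnclosureHistoryAutonomyComparisonDualOrbit

open Literature.MathematicalPhysics.QuantumFieldTheory.Balaban1983to89
open Literature.MathematicalPhysics.QuantumFieldTheory.Balaban1983to89.T4BetaStationary
open Literature.MathematicalPhysics.QuantumFieldTheory.Balaban1983to89.T4BetaFlowWellPosed
open Summit.QuantumFields.BalabanUV.Beta.EriceRemainderEnclosureHistoryAutonomyOrder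
  (family_zero family_mem family_tail_eq family_succ_eq le_of_pin_le)

variable {B B' : (ℕ → ℝ) → ℝ} {M γ b : ℝ} {S : ℝ → ℕ → ℝ} {h' : ℕ → ℝ}

/-! ## §1 Comparison from the dual step quantities -/

/-- **COMPARISON FROM THE DUAL STEP QUANTITIES.**  Base functional `B`: isotone, floor `b > 0`, modulus `M`, a unique box solution `S p` from every pin `p ∈ ]0,γ]`.
Perturbed functional `B′`: arbitrary; `h′` a box solution of `B′` from the pin `y`.  If the dual step quantities are non-negative down to depth `n`,
`B((S h′_j)_1, (S h′_j)_2, …) ≤ B′(h′_{j+1}, h′_{j+2}, …)` for `j < n`, then `h′_j ≤ (S y)_j` for every `j ≤ n`: at each row the perturbed level gains at least what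
the base restarted at the same pin gains, and the base's one-step map is monotone in the pin. [folklore] -/
theorem cmp_of_dual_steps_nonneg (hb : 0 < b)
    (hB : ∀ u u' : ℕ → ℝ, SeqBox γ u → SeqBox γ u' → ∀ D : ℝ, (∀ j, |u j - u' j| ≤ D) → |B u - B u'| ≤ M * D) (hM : 0 ≤ M)
    (hlo : ∀ u, SeqBox γ u → b ≤ B u)
    (hS : ∀ p, 0 < p → p ≤ γ → SeqBox γ (S p) ∧ MemFlow B p (S p))
    (huniq : ∀ p, 0 < p → p ≤ γ → ∀ u u' : ℕ → ℝ, SeqBox γ u → SeqBox γ u' → MemFlow B p u → MemFlow B p u' → u = u')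
    {y : ℝ} (hy : 0 < y) (hyγ : y ≤ γ) (hh' : SeqBox γ h') (hf' : MemFlow B' y h') (n : ℕ)
    (hX : ∀ j, j < n → B (fun i => S (h' j) (1 + i)) ≤ B' (fun i => h' (j + 1 + i))) :
    ∀ j, j ≤ n → h' j ≤ S y j := by
  intro j
  induction j with
  | zero => intro _; rw [hf'.1, family_zero hS hy hyγ]
  | succ j ih =>
    intro hj
    have hjn : j < n := by omega
    have hprev : h' j ≤ S y j := ih (by omega)
    have hpj : 0 < h' j := (hh' j).1
    have hpjγ : h' j ≤ γ := (hh' j).2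
    -- the base restarted at h′_j: its first step
    have hSj := hS (h' j) hpj hpjγ
    have hstep0 : 1 / S (h' j) (0 + 1) ^ 2 = 1 / S (h' j) 0 ^ 2 + B (fun i => S (h' j) (0 + 1 + i)) := hSj.2.2 0
    rw [family_zero hS hpj hpjγ, show (0 : ℕ) + 1 = 1 from rfl] at hstep0
    have e1 : (fun i => S (h' j) (0 + 1 + i)) = (fun i => S (h' j) (1 + i)) := by funext i; simp
    rw [e1] at hstep0
    -- the perturbed step
    have hstep' : 1 / h' (j + 1) ^ 2 = 1 / h' j ^ 2 + B' (fun i => h' (j + 1 + i)) := hf'.2 j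
    have hge : 1 / S (h' j) 1 ^ 2 ≤ 1 / h' (j + 1) ^ 2 := by rw [hstep0, hstep']; linarith [hX j hjn]
    -- base one-step monotonicity in the pin: S (h′_j) 1 ≤ S (S y j) 1 = S y (j+1)
    have hqj := family_mem hS hy hyγ j
    have hmono1 : S (h' j) 1 ≤ S (S y j) 1 :=
      le_of_pin_le hb hB hM hlo huniq hpj hprev hqj.2 hSj.1 (hS _ hqj.1 hqj.2).1 hSj.2 (hS _ hqj.1 hqj.2).2 1
    rw [← family_succ_eq hS huniq hy hyγ j] at hmono1
    -- conclude from the levels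
    have hpos1 : 0 < h' (j + 1) := (hh' (j + 1)).1
    have hposS : 0 < S (h' j) 1 := (hSj.1 1).1
    have hposY : 0 < S y (j + 1) := ((hS y hy hyγ).1 (j + 1)).1
    have hlev : 1 / S y (j + 1) ^ 2 ≤ 1 / S (h' j) 1 ^ 2 :=
      one_div_le_one_div_of_le (pow_pos hposS 2) (pow_le_pow_left₀ hposS.le hmono1 2)
    have hfin : 1 / S y (j + 1) ^ 2 ≤ 1 / h' (j + 1) ^ 2 := hlev.trans hge
    -- 1/a² ≤ 1/c² with a, c > 0 gives c ≤ a
    have hsq : h' (j + 1) ^ 2 ≤ S y (j + 1) ^ 2 := (one_div_le_one_div (pow_pos hposY 2) (pow_pos hpos1 2)).mp hfin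
    exact (pow_le_pow_iff_left₀ hpos1.le hposY.le two_ne_zero).mp hsq

/-! ## §2 The dual window gap -/

/-- The dual window gap vanishes at age `0`: `1∕h′_j² − 1∕(S h′_j)_0² = 0`. [folklore] -/
theorem dual_gap_zero (hS : ∀ p, 0 < p → p ≤ γ → SeqBox γ (S p) ∧ MemFlow B p (S p)) (hh' : SeqBox γ h') (j : ℕ) :
    1 / h' (j + 0) ^ 2 - 1 / S (h' j) 0 ^ 2 = 0 := by
  rw [family_zero hS (hh' j).1 (hh' j).2, Nat.add_zero, sub_self]

/-- **THE DUAL GAP GROWS BY AT MOST THE DUAL STEP QUANTITY.**  With `δ_k := 1∕h′_{j+k}² − 1∕(S h′_j)_k²`: exactly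
`δ_{k+1} − δ_k = X′_{j+k} + [B((S h′_{j+k})_1, …) − B((S h′_j)_{k+1}, …)]`, and the bracket is `≤ 0` when `h′_{j+k} ≤ (S h′_j)_k` — the tail of the base orbit from
`h′_j` beyond row `k` IS the base orbit from `(S h′_j)_k` (autonomy), whose effective β dominates that from the smaller pin `h′_{j+k}` (`le_of_pin_le`, `B` isotone).
So `δ_{k+1} ≤ δ_k + X′_{j+k}` — the lattice form of the continuum's `D′ ≤ X` (g103 README §2 (F2)). [folklore] -/
theorem dual_gap_step (hb : 0 < b)
    (hmono : ∀ u v : ℕ → ℝ, SeqBox γ u → SeqBox γ v → (∀ j, u j ≤ v j) → B u ≤ B v)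
    (hB : ∀ u u' : ℕ → ℝ, SeqBox γ u → SeqBox γ u' → ∀ D : ℝ, (∀ j, |u j - u' j| ≤ D) → |B u - B u'| ≤ M * D) (hM : 0 ≤ M)
    (hlo : ∀ u, SeqBox γ u → b ≤ B u)
    (hS : ∀ p, 0 < p → p ≤ γ → SeqBox γ (S p) ∧ MemFlow B p (S p))
    (huniq : ∀ p, 0 < p → p ≤ γ → ∀ u u' : ℕ → ℝ, SeqBox γ u → SeqBox γ u' → MemFlow B p u → MemFlow B p u' → u = u')
    (hh' : SeqBox γ h') {y : ℝ} (hf' : MemFlow B' y h') (j k : ℕ) (hcmp : h' (j + k) ≤ S (h' j) k) :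
    (1 / h' (j + (k + 1)) ^ 2 - 1 / S (h' j) (k + 1) ^ 2) - (1 / h' (j + k) ^ 2 - 1 / S (h' j) k ^ 2)
      ≤ B' (fun i => h' (j + k + 1 + i)) - B (fun i => S (h' (j + k)) (1 + i)) := by
  have hpj : 0 < h' j := (hh' j).1
  have hpjγ : h' j ≤ γ := (hh' j).2
  have hSj := hS (h' j) hpj hpjγ
  -- the two recursions
  have hpert : 1 / h' (j + (k + 1)) ^ 2 = 1 / h' (j + k) ^ 2 + B' (fun i => h' (j + k + 1 + i)) := by
    rw [show j + (k + 1) = j + k + 1 by ring]; exact hf'.2 (j + k)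
  have hbase : 1 / S (h' j) (k + 1) ^ 2 = 1 / S (h' j) k ^ 2 + B (fun i => S (h' j) (k + 1 + i)) := hSj.2.2 k
  -- autonomy: the tail of S (h′_j) beyond k is S ((S h′_j)_k)
  have hqk := family_mem hS hpj hpjγ k
  have htail : (fun i => S (h' j) (k + 1 + i)) = (fun i => S (S (h' j) k) (1 + i)) := by
    funext i
    have := congrFun (family_tail_eq hS huniq hpj hpjγ k) (1 + i)
    simpa [Nat.add_assoc] using this
  -- pin monotonicity: S (h′_{j+k}) ≤ S ((S h′_j)_k) componentwise
  have hpk : 0 < h' (j + k) := (hh' (j + k)).1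
  have hSk := hS (h' (j + k)) hpk (hh' (j + k)).2
  have hle : ∀ i, S (h' (j + k)) (1 + i) ≤ S (S (h' j) k) (1 + i) := fun i =>
    le_of_pin_le hb hB hM hlo huniq hpk hcmp hqk.2 hSk.1 (hS _ hqk.1 hqk.2).1 hSk.2 (hS _ hqk.1 hqk.2).2 (1 + i)
  have hBle : B (fun i => S (h' (j + k)) (1 + i)) ≤ B (fun i => S (S (h' j) k) (1 + i)) :=
    hmono _ _ (fun i => hSk.1 (1 + i)) (fun i => (hS _ hqk.1 hqk.2).1 (1 + i)) hle
  rw [hpert, hbase, htail]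
  linarith

/-- **THE DUAL WINDOW GAP IS NON-NEGATIVE AND AT MOST THE SUM OF THE DUAL STEP QUANTITIES** — no modulus of the excess, no size condition.  If the dual step quantities
`X′_{j+l}`, `l < k`, are non-negative (so that comparison holds along the window, §1) then
`0 ≤ 1∕h′_{j+k}² − 1∕(S h′_j)_k² ≤ Σ_{l<k} X′_{j+l}` — the window top of the perturbed orbit `k` rows above its pin `h′_j` is higher than the base's from the same
pin by at most the step quantities accumulated over the window (the continuum's `0 ≤ ℓ^η − ℓ⁰ ≤ ∫_window X dτ`). [folklore] -/
theorem dual_gap_le_sum_steps (hb : 0 < b)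
    (hmono : ∀ u v : ℕ → ℝ, SeqBox γ u → SeqBox γ v → (∀ j, u j ≤ v j) → B u ≤ B v)
    (hB : ∀ u u' : ℕ → ℝ, SeqBox γ u → SeqBox γ u' → ∀ D : ℝ, (∀ j, |u j - u' j| ≤ D) → |B u - B u'| ≤ M * D) (hM : 0 ≤ M)
    (hlo : ∀ u, SeqBox γ u → b ≤ B u)
    (hS : ∀ p, 0 < p → p ≤ γ → SeqBox γ (S p) ∧ MemFlow B p (S p))
    (huniq : ∀ p, 0 < p → p ≤ γ → ∀ u u' : ℕ → ℝ, SeqBox γ u → SeqBox γ u' → MemFlow B p u → MemFlow B p u' → u = u')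
    (hh' : SeqBox γ h') {y : ℝ} (hf' : MemFlow B' y h') (j k : ℕ)
    (hX : ∀ l, l < k → 0 ≤ B' (fun i => h' (j + l + 1 + i)) - B (fun i => S (h' (j + l)) (1 + i))) :
    0 ≤ 1 / h' (j + k) ^ 2 - 1 / S (h' j) k ^ 2
      ∧ 1 / h' (j + k) ^ 2 - 1 / S (h' j) k ^ 2 ≤ ∑ l ∈ range k, (B' (fun i => h' (j + l + 1 + i)) - B (fun i => S (h' (j + l)) (1 + i))) := by
  have hpj : 0 < h' j := (hh' j).1
  have hpjγ : h' j ≤ γ := (hh' j).2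
  have hSj := hS (h' j) hpj hpjγ
  -- comparison along the window from the tail orbit h′_{j+·} (a B′-solution from the pin h′_j)
  have htailbox : SeqBox γ (fun i => h' (j + i)) := fun i => hh' (j + i)
  have htailflow : MemFlow B' (h' j) (fun i => h' (j + i)) := by
    refine ⟨by simp, fun m => ?_⟩
    have := hf'.2 (j + m)
    simpa [Nat.add_assoc] using this
  have hcmp : ∀ l, l ≤ k → h' (j + l) ≤ S (h' j) l := by
    intro l hl
    have := cmp_of_dual_steps_nonneg (B' := B') hb hB hM hlo hS huniq hpj hpjγ htailbox htailflow k
      (fun i hi => by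
        have h1 := hX i hi
        have e : (fun i_1 => h' (j + (i + 1 + i_1))) = (fun i_1 => h' (j + i + 1 + i_1)) := by funext q; simp [Nat.add_assoc]
        rw [e]; linarith) l hl
    simpa using this
  induction k with
  | zero =>
    simp only [Nat.add_zero, sum_range_zero]
    rw [family_zero hS hpj hpjγ]; constructor <;> simp
  | succ k ih =>
    have hX' : ∀ l, l < k → 0 ≤ B' (fun i => h' (j + l + 1 + i)) - B (fun i => S (h' (j + l)) (1 + i)) := fun l hl => hX l (by omega)
    have hcmp' : ∀ l, l ≤ k → h' (j + l) ≤ S (h' j) l := fun l hl => hcmp l (by omega)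
    obtain ⟨ih0, ih1⟩ := ih hX' hcmp'
    have hstep := dual_gap_step (B' := B') hb hmono hB hM hlo hS huniq hh' hf' j k (hcmp k (Nat.le_succ k))
    constructor
    · -- non-negativity from comparison at row k+1
      have hc := hcmp (k + 1) le_rfl
      have hp1 : 0 < h' (j + (k + 1)) := (hh' _).1
      exact sub_nonneg.mpr (one_div_le_one_div_of_le (pow_pos hp1 2) (pow_le_pow_left₀ hp1.le hc 2))
    · rw [sum_range_succ]
      linarith [hX k (lt_add_one k)]

/-! ## §3 (v1.1) Bricks of the dual row inequality: the drop identity, the source monotonicity, the base two-pin offset -/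

/-- **THE DUAL STEP QUANTITY IS THE EXCESS ON THE PERTURBED TAIL MINUS THE AFFINE DROP.**  For the affine base `B u = β₀ + Σ_{k<K} L_k u_k` (on the box) and ANY `B′`
with a box solution `h′` from `y`:  `X′_j = (B′ − B)(tail_{j+1}h′) − Σ_{k<K} L_k·((S h′_j)_{1+k} − h′_{j+1+k})` — the dual of (E118a) `step_eq_drop`; the bracket is the
age-`k` coupling gap between the base restarted at `h′_j` and the perturbed orbit (non-negative under comparison, §1). [folklore] -/
theorem dual_step_eq_drop {β₀ : ℝ} {L : ℕ → ℝ} {K : ℕ} (hBaff : ∀ u, SeqBox γ u → B u = β₀ + ∑ k ∈ range K, L k * u k)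
    (hS : ∀ p, 0 < p → p ≤ γ → SeqBox γ (S p) ∧ MemFlow B p (S p)) (hh' : SeqBox γ h') (j : ℕ) :
    B' (fun i => h' (j + 1 + i)) - B (fun i => S (h' j) (1 + i))
      = (B' (fun i => h' (j + 1 + i)) - B (fun i => h' (j + 1 + i))) - ∑ k ∈ range K, L k * (S (h' j) (1 + k) - h' (j + 1 + k)) := by
  have hb1 : SeqBox γ (fun i => h' (j + 1 + i)) := fun i => hh' (j + 1 + i)
  have hb2 : SeqBox γ (fun i => S (h' j) (1 + i)) := fun i => (hS (h' j) (hh' j).1 (hh' j).2).1 (1 + i)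
  rw [hBaff _ hb1, hBaff _ hb2]
  have e : ∑ k ∈ range K, L k * (S (h' j) (1 + k) - h' (j + 1 + k)) = ∑ k ∈ range K, L k * S (h' j) (1 + k) - ∑ k ∈ range K, L k * h' (j + 1 + k) := by
    rw [← sum_sub_distrib]; exact sum_congr rfl fun k _ => by ring
  rw [e]; ring

/-- **THE SOURCE ONLY GROWS GOING DOWN ONE ORBIT.**  If the excess `B′ − B` is isotone along ordered box configurations and `h′` is non-increasing (every box solution
of a functional with a positive floor is, (E48a) `strictAnti_of_memFlow`), then `(B′−B)(tail_{j+2}h′) ≤ (B′−B)(tail_{j+1}h′)`: the tails of ONE orbit are componentwise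
ordered.  This is the lattice form of the continuum's `ηe′ ≤ 0` — NO modulus, NO steepness, NO size; sources read at older couplings are included (any isotone
functional of the tail). [folklore] -/
theorem dual_source_antitone
    (hDmono : ∀ u v : ℕ → ℝ, SeqBox γ u → SeqBox γ v → (∀ i, u i ≤ v i) → B' u - B u ≤ B' v - B v)
    (hh' : SeqBox γ h') (hanti : Antitone h') (j : ℕ) :
    B' (fun i => h' (j + 2 + i)) - B (fun i => h' (j + 2 + i)) ≤ B' (fun i => h' (j + 1 + i)) - B (fun i => h' (j + 1 + i)) :=
  hDmono _ _ (fun i => hh' (j + 2 + i)) (fun i => hh' (j + 1 + i)) (fun i => hanti (by omega))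

/-- **TWO BASE ORBITS FROM ORDERED PINS: THE LEVEL GAP NEVER EXCEEDS THE PIN GAP** (isotone `B` only; (E63a) `levelGap_le_pin_gap` re-proved here to keep the
imports minimal): box solutions `k` from `z` and `k′` from `z′` with `k′ ≤ k` at every scale satisfy `1∕k′_j² − 1∕k_j² ≤ 1∕z′² − 1∕z²`. [folklore] -/
theorem base_gap_damped {k k' : ℕ → ℝ} {z z' : ℝ}
    (hmono : ∀ u v : ℕ → ℝ, SeqBox γ u → SeqBox γ v → (∀ i, u i ≤ v i) → B u ≤ B v)
    (hk : SeqBox γ k) (hfk : MemFlow B z k) (hk' : SeqBox γ k') (hfk' : MemFlow B z' k') (hle : ∀ i, k' i ≤ k i) :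
    ∀ j : ℕ, 1 / k' j ^ 2 - 1 / k j ^ 2 ≤ 1 / z' ^ 2 - 1 / z ^ 2
  | 0 => by rw [hfk.1, hfk'.1]
  | j + 1 => by
    have h1 : 1 / k (j + 1) ^ 2 = 1 / k j ^ 2 + B (fun i => k (j + 1 + i)) := hfk.2 j
    have h2 : 1 / k' (j + 1) ^ 2 = 1 / k' j ^ 2 + B (fun i => k' (j + 1 + i)) := hfk'.2 j
    have hB : B (fun i => k' (j + 1 + i)) ≤ B (fun i => k (j + 1 + i)) :=
      hmono _ _ (fun i => hk' (j + 1 + i)) (fun i => hk (j + 1 + i)) (fun i => hle (j + 1 + i))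
    have ih := base_gap_damped hmono hk hfk hk' hfk' hle j
    rw [h1, h2]; linarith

/-- **THE TWO-PIN OFFSET ON THE BASE SIDE.**  Base `B` isotone with floor `b > 0`, modulus `M`, unique box solutions; `h′` a box solution of ANY `B′` from `y`, non-increasing.
The base orbits restarted at the consecutive perturbed pins `h′_{j+1} ≤ h′_j` are ordered (`le_of_pin_le`) and, by `base_gap_damped` and the cube inequality, their
age-`k` couplings differ by at most `((S h′_j)_k³∕2)·(1∕h′_{j+1}² − 1∕h′_j²)` — cube∕2 times the perturbed orbit's level step `B′(tail_{j+1}h′)` at the pin.  (The finer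
damping by the base speed ratio top∕pin — the continuum's `Φ₀(ℓ⁰)∕Φ₀(α)` inside `m⁰_r` — is (E116)∕(E117)'s rate decay and is the successor's next brick.) [folklore] -/
theorem dual_base_top_gap_le (hb : 0 < b)
    (hmono : ∀ u v : ℕ → ℝ, SeqBox γ u → SeqBox γ v → (∀ i, u i ≤ v i) → B u ≤ B v)
    (hB : ∀ u u' : ℕ → ℝ, SeqBox γ u → SeqBox γ u' → ∀ D : ℝ, (∀ j, |u j - u' j| ≤ D) → |B u - B u'| ≤ M * D) (hM : 0 ≤ M)
    (hlo : ∀ u, SeqBox γ u → b ≤ B u)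
    (hS : ∀ p, 0 < p → p ≤ γ → SeqBox γ (S p) ∧ MemFlow B p (S p))
    (huniq : ∀ p, 0 < p → p ≤ γ → ∀ u u' : ℕ → ℝ, SeqBox γ u → SeqBox γ u' → MemFlow B p u → MemFlow B p u' → u = u')
    (hh' : SeqBox γ h') (hanti : Antitone h') (j k : ℕ) :
    0 ≤ S (h' j) k - S (h' (j + 1)) k
      ∧ S (h' j) k - S (h' (j + 1)) k ≤ S (h' j) k ^ 3 / 2 * (1 / h' (j + 1) ^ 2 - 1 / h' j ^ 2) := by
  have hpj : 0 < h' j := (hh' j).1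
  have hpj1 : 0 < h' (j + 1) := (hh' (j + 1)).1
  have hle1 : h' (j + 1) ≤ h' j := hanti (Nat.le_succ j)
  have hSj := hS (h' j) hpj (hh' j).2
  have hSj1 := hS (h' (j + 1)) hpj1 (hh' (j + 1)).2
  have hle : ∀ i, S (h' (j + 1)) i ≤ S (h' j) i := fun i =>
    le_of_pin_le hb hB hM hlo huniq hpj1 hle1 (hh' j).2 hSj1.1 hSj.1 hSj1.2 hSj.2 i
  refine ⟨by linarith [hle k], ?_⟩
  have hkj := (hSj.1 k).1
  have hk'j := (hSj1.1 k).1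
  have hg0 : 0 ≤ S (h' j) k - S (h' (j + 1)) k := by linarith [hle k]
  have hδ0 : 0 ≤ 1 / S (h' (j + 1)) k ^ 2 - 1 / S (h' j) k ^ 2 :=
    sub_nonneg.mpr (one_div_le_one_div_of_le (pow_pos hk'j 2) (pow_le_pow_left₀ hk'j.le (hle k) 2))
  have hw := Literature.MathematicalPhysics.QuantumFieldTheory.Balaban1983to89.T4BetaFlowWellPosed.Sharpness.abs_sub_le_half_cube_mul hkj hk'j le_rfl (hle k)
  rw [abs_of_nonneg hg0, abs_sub_comm, abs_of_nonneg hδ0] at hw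
  have hgap := base_gap_damped hmono hSj.1 hSj.2 hSj1.1 hSj1.2 hle k
  exact hw.trans (mul_le_mul_of_nonneg_left hgap (by positivity))

/-! ## §4 (v1.2) «Φ₀√ℓ isotone» on the lattice: the normalised orbit is antitone in the pin -/

/-- **THE ONE-STEP RATIO IS ANTITONE IN THE PIN.**  Base `B` isotone with floor `b > 0`, modulus, unique box solutions `S p`; one-step map `f(p) = (S p)_1` with
`1∕f(p)² = 1∕p² + B((S p)_1, (S p)_2, …)`.  For pins `0 < p′ ≤ p ≤ γ`: `f(p)·p′ ≤ f(p′)·p` — because `(p∕f(p))² = 1 + p²·B(tail S p)` and both factors grow with the pin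
(`le_of_pin_le`, `B` isotone).  Continuum: `Φ₀(α)∕α` is antitone in the level. [folklore] -/
theorem one_step_ratio_le (hb : 0 < b)
    (hmono : ∀ u v : ℕ → ℝ, SeqBox γ u → SeqBox γ v → (∀ i, u i ≤ v i) → B u ≤ B v)
    (hB : ∀ u u' : ℕ → ℝ, SeqBox γ u → SeqBox γ u' → ∀ D : ℝ, (∀ j, |u j - u' j| ≤ D) → |B u - B u'| ≤ M * D) (hM : 0 ≤ M)
    (hlo : ∀ u, SeqBox γ u → b ≤ B u)
    (hS : ∀ p, 0 < p → p ≤ γ → SeqBox γ (S p) ∧ MemFlow B p (S p))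
    (huniq : ∀ p, 0 < p → p ≤ γ → ∀ u u' : ℕ → ℝ, SeqBox γ u → SeqBox γ u' → MemFlow B p u → MemFlow B p u' → u = u')
    {p p' : ℝ} (hp' : 0 < p') (hp'p : p' ≤ p) (hpγ : p ≤ γ) :
    S p 1 * p' ≤ S p' 1 * p := by
  have hp : 0 < p := hp'.trans_le hp'p
  have hp'γ : p' ≤ γ := hp'p.trans hpγ
  have hSp := hS p hp hpγ
  have hSp' := hS p' hp' hp'γ
  have hF : 0 < S p 1 := (hSp.1 1).1
  have hF' : 0 < S p' 1 := (hSp'.1 1).1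
  -- the two one-step equations
  have e1 : 1 / S p (0 + 1) ^ 2 = 1 / S p 0 ^ 2 + B (fun i => S p (0 + 1 + i)) := hSp.2.2 0
  have e2 : 1 / S p' (0 + 1) ^ 2 = 1 / S p' 0 ^ 2 + B (fun i => S p' (0 + 1 + i)) := hSp'.2.2 0
  rw [family_zero hS hp hpγ, show (0 : ℕ) + 1 = 1 from rfl] at e1
  rw [family_zero hS hp' hp'γ, show (0 : ℕ) + 1 = 1 from rfl] at e2
  set β := B (fun i => S p (0 + 1 + i)) with hβdef
  set β' := B (fun i => S p' (0 + 1 + i)) with hβ'def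
  -- β′ ≤ β (pin monotonicity + isotone B) and β′ ≥ b > 0
  have hle : ∀ i, S p' i ≤ S p i := fun i => le_of_pin_le hb hB hM hlo huniq hp' hp'p hpγ hSp'.1 hSp.1 hSp'.2 hSp.2 i
  have hββ : β' ≤ β := hmono _ _ (fun i => hSp'.1 (0 + 1 + i)) (fun i => hSp.1 (0 + 1 + i)) (fun i => hle (0 + 1 + i))
  have hβ'0 : 0 < β' := hb.trans_le (hlo _ (fun i => hSp'.1 (0 + 1 + i)))
  have hβ0 : 0 < β := hβ'0.trans_le hββ
  -- squares: (S p 1)² = 1/(1/p² + β), (S p′ 1)² = 1/(1/p′² + β′)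
  have hD : 0 < 1 / p ^ 2 + β := by positivity
  have hD' : 0 < 1 / p' ^ 2 + β' := by positivity
  have hsq : S p 1 ^ 2 = 1 / (1 / p ^ 2 + β) := by
    rw [← e1, one_div_one_div]
  have hsq' : S p' 1 ^ 2 = 1 / (1 / p' ^ 2 + β') := by
    rw [← e2, one_div_one_div]
  -- the key inequality between the squares: p′²/(1/p²+β) ≤ p²/(1/p′²+β′)  ⟸  p′²(1/p′²+β′) ≤ p²(1/p²+β)
  have hkey : (S p 1 * p') ^ 2 ≤ (S p' 1 * p) ^ 2 := by
    rw [mul_pow, mul_pow, hsq, hsq', one_div_mul_eq_div, one_div_mul_eq_div, div_le_div_iff₀ hD hD']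
    have h1 : p' ^ 2 * β' ≤ p ^ 2 * β := by
      have := mul_le_mul (pow_le_pow_left₀ hp'.le hp'p 2) hββ hβ'0.le (by positivity)
      linarith
    have ep : p' ^ 2 * (1 / p' ^ 2 + β') = 1 + p' ^ 2 * β' := by field_simp
    have ep' : p ^ 2 * (1 / p ^ 2 + β) = 1 + p ^ 2 * β := by field_simp
    nlinarith [ep, ep', h1]
  exact (pow_le_pow_iff_left₀ (by positivity) (by positivity) two_ne_zero).mp hkey

/-- **THE NORMALISED ORBIT IS ANTITONE IN THE PIN, AT EVERY SCALE**: for pins `0 < p′ ≤ p ≤ γ`, `(S p)_k·p′ ≤ (S p′)_k·p` — iterate `one_step_ratio_le` along the two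
orbits (`family_succ_eq`; the scale maps are monotone in the pin).  Continuum: `ℓ∕ℓ_r(ℓ)` non-decreasing, i.e. `Φ₀√ℓ` isotone block by block. [folklore] -/
theorem scale_ratio_le (hb : 0 < b)
    (hmono : ∀ u v : ℕ → ℝ, SeqBox γ u → SeqBox γ v → (∀ i, u i ≤ v i) → B u ≤ B v)
    (hB : ∀ u u' : ℕ → ℝ, SeqBox γ u → SeqBox γ u' → ∀ D : ℝ, (∀ j, |u j - u' j| ≤ D) → |B u - B u'| ≤ M * D) (hM : 0 ≤ M)
    (hlo : ∀ u, SeqBox γ u → b ≤ B u)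
    (hS : ∀ p, 0 < p → p ≤ γ → SeqBox γ (S p) ∧ MemFlow B p (S p))
    (huniq : ∀ p, 0 < p → p ≤ γ → ∀ u u' : ℕ → ℝ, SeqBox γ u → SeqBox γ u' → MemFlow B p u → MemFlow B p u' → u = u')
    {p p' : ℝ} (hp' : 0 < p') (hp'p : p' ≤ p) (hpγ : p ≤ γ) : ∀ k : ℕ, S p k * p' ≤ S p' k * p
  | 0 => by
    rw [family_zero hS (hp'.trans_le hp'p) hpγ, family_zero hS hp' (hp'p.trans hpγ), mul_comm]
  | k + 1 => by
    have hp : 0 < p := hp'.trans_le hp'p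
    have hp'γ : p' ≤ γ := hp'p.trans hpγ
    have ih := scale_ratio_le hb hmono hB hM hlo hS huniq hp' hp'p hpγ k
    -- a := S p k ≥ a′ := S p′ k, both pins in the box
    have ha := family_mem hS hp hpγ k
    have ha' := family_mem hS hp' hp'γ k
    have haa : S p' k ≤ S p k := le_of_pin_le hb hB hM hlo huniq hp' hp'p hpγ (hS p' hp' hp'γ).1 (hS p hp hpγ).1 (hS p' hp' hp'γ).2 (hS p hp hpγ).2 k
    have hstep := one_step_ratio_le hb hmono hB hM hlo hS huniq ha'.1 haa ha.2
    -- S p (k+1) = S (S p k) 1 etc.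
    rw [family_succ_eq hS huniq hp hpγ k, family_succ_eq hS huniq hp' hp'γ k]
    -- f(a)·a′ ≤ f(a′)·a and a·p′ ≤ a′·p  ⟹  f(a)·p′ ≤ f(a′)·p
    have hfa : 0 < S (S p k) 1 := ((hS _ ha.1 ha.2).1 1).1
    have hfa' : 0 < S (S p' k) 1 := ((hS _ ha'.1 ha'.2).1 1).1
    have h1 : S (S p k) 1 * p' * S p' k ≤ S (S p' k) 1 * p * S p' k := by nlinarith [mul_le_mul_of_nonneg_left ih hfa.le, mul_le_mul_of_nonneg_right hstep hp'.le]
    by_cases hz : S p' k = 0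
    · exact absurd hz (ne_of_gt ha'.1)
    · exact le_of_mul_le_mul_right h1 ha'.1

/-- **«Φ₀√ℓ ISOTONE» FOR THE AFFINE BASE.**  `B u = β₀ + Σ_{k<K} L_k u_k` on the box (`β₀ ≥ 0`, `L ≥ 0`), isotone with floor, modulus, unique solutions: for pins
`0 < p′ ≤ p ≤ γ`, `p′·B((S p)_1, (S p)_2, …) ≤ p·B((S p′)_1, (S p′)_2, …)` — the base's effective β at a higher pin is at least the coupling ratio times its value at the
lower pin.  This is the lower bound `Φ₀(ℓ^η) ≥ Φ₀(ℓ⁰)(ℓ⁰∕ℓ^η)^{1∕2}` on the speed at the perturbed top used in the deficit of the continuum proof (g103 README §2). [folklore] -/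
theorem affine_speed_ratio_le {β₀ : ℝ} {L : ℕ → ℝ} {K : ℕ} (hBaff : ∀ u, SeqBox γ u → B u = β₀ + ∑ k ∈ range K, L k * u k) (hβ₀ : 0 ≤ β₀) (hL : ∀ k, 0 ≤ L k)
    (hb : 0 < b)
    (hmono : ∀ u v : ℕ → ℝ, SeqBox γ u → SeqBox γ v → (∀ i, u i ≤ v i) → B u ≤ B v)
    (hB : ∀ u u' : ℕ → ℝ, SeqBox γ u → SeqBox γ u' → ∀ D : ℝ, (∀ j, |u j - u' j| ≤ D) → |B u - B u'| ≤ M * D) (hM : 0 ≤ M)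
    (hlo : ∀ u, SeqBox γ u → b ≤ B u)
    (hS : ∀ p, 0 < p → p ≤ γ → SeqBox γ (S p) ∧ MemFlow B p (S p))
    (huniq : ∀ p, 0 < p → p ≤ γ → ∀ u u' : ℕ → ℝ, SeqBox γ u → SeqBox γ u' → MemFlow B p u → MemFlow B p u' → u = u')
    {p p' : ℝ} (hp' : 0 < p') (hp'p : p' ≤ p) (hpγ : p ≤ γ) :
    p' * B (fun i => S p (1 + i)) ≤ p * B (fun i => S p' (1 + i)) := by
  have hp : 0 < p := hp'.trans_le hp'p
  have hp'γ : p' ≤ γ := hp'p.trans hpγ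
  have hb1 : SeqBox γ (fun i => S p (1 + i)) := fun i => (hS p hp hpγ).1 (1 + i)
  have hb2 : SeqBox γ (fun i => S p' (1 + i)) := fun i => (hS p' hp' hp'γ).1 (1 + i)
  rw [hBaff _ hb1, hBaff _ hb2, mul_add, mul_add, mul_sum, mul_sum]
  have h0 : p' * β₀ ≤ p * β₀ := mul_le_mul_of_nonneg_right hp'p hβ₀
  have hterm : ∀ k ∈ range K, p' * (L k * S p (1 + k)) ≤ p * (L k * S p' (1 + k)) := by
    intro k _
    have hr := scale_ratio_le hb hmono hB hM hlo hS huniq hp' hp'p hpγ (1 + k)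
    have := mul_le_mul_of_nonneg_left hr (hL k)
    nlinarith [this]
  linarith [sum_le_sum hterm]

end Summit.QuantumFields.BalabanUV.Beta.EriceRemainderEnclosureHistoryAutonomyComparisonDualOrbit

end
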